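import Literature.MathematicalPhysics.QuantumFieldTheory.SliceKernelHellmannFeynman
import Literature.Analysis.OperatorTheory.KernelFamilyOperatorDerivative
import Literature.Analysis.OperatorTheory.TopEigenvalueDerivativeGap
import Literature.MathematicalPhysics.QuantumFieldTheory.WilsonTorusTransferMatrix
import HarnessLib

/-!
# The slice transfer operators of lattice gauge theory are differentiable in the couplings IN OPERATOR
# NORM; hence `∂ log λ₀` EXISTS and equals the Hellmann–Feynman value (Kato II-§5.4 / VIII-§2.3, m = 1)

Literature layer, topic `MathematicalPhysics/QuantumFieldTheory`; companion of `SliceKernelHellmannFeynman.lean`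
(which differentiates the MATRIX ELEMENTS `J ↦ ⟪φ, S_J ψ⟫` of the slice transfer operators with frozen
vectors and brackets the Hellmann–Feynman value between secant slopes of the convex `log ‖S ·‖`, "with NO
differentiability of `λ₀` assumed"). Here the missing differentiability is PROVED:

* `continuous_integral_fibre` — continuity of `p ↦ ∫ F(p, E) dE` for jointly continuous `F` on compact
  spaces (dominated convergence), used for the joint measurability of the derivative kernels;
* ★ `hasDerivAt_sliceKernelOp_elec` / `hasDerivAt_sliceKernelOp_mag`: for bounded operators `S J` on
  `L²(μ)` (`μ` any finite measure on the spatial link configurations) given a.e. by the kernels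
  `sliceKernel ρ J_E J_M` in the electric coupling `J_E` (resp. the magnetic coupling `J_M`) and `S′`
  an operator given a.e. by the derivative kernel (temporal-plaquette insertion
  `e^{J_M m(a)/2}(∫ e^{J₀ q} q dE)e^{J_M m(b)/2}`, resp. `sliceKernel · (m(a)+m(b))/2`), the family is
  differentiable at `J₀` IN OPERATOR NORM: `HasDerivAt S S′ J₀`. Proof: the kernels are `C²` in the
  coupling with second derivatives bounded uniformly on the compact configuration space
  (`hasDerivAt_integral_exp_mul_pow`), so the kernel Taylor remainder is `O((J-J₀)²)` uniformly and
  `KernelFamilyOperatorDerivative.hasDerivAt_kernelOp_of_abs_deriv_two_le` applies.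
* ★★ `exists_hasDerivAt_log_norm_sliceKernelOp_elec` / `_mag` — END TO END: if moreover `ρ` is unitary
  (symmetric kernel ⟹ `S J` self-adjoint), `μ ≠ 0`, and `S J ⪰ 0` for `J` near `J₀` (reflection
  positivity; an explicit hypothesis here), then with `φ` the Perron–Jentzsch vector of `S J₀` (unit, a.e.
  positive top eigenvector — `S J₀` is compact and positivity improving since the kernel is bounded,
  continuous and strictly positive), the function `J ↦ log ‖S J‖` is DIFFERENTIABLE at `J₀` with
  derivative `⟪φ, S′φ⟫/‖S J₀‖`, and for every `h > 0` this derivative lies between the secant slopes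
  `(log‖S_{J₀}‖ - log‖S_{J₀-h}‖)/h` and `(log‖S_{J₀+h}‖ - log‖S_{J₀}‖)/h` (Kingman convexity,
  `convexOn_log_norm_sliceKernelOp_elec/_mag`). So the FLOW-TABLE sentence «the β_t/β_s-derivative of
  `ln λ̂₀` is enclosed by the chords» is a theorem about THE DERIVATIVE (`TopEigenvalueDerivativeGap`).

* ★★★ `hasDerivAt_wilsonTorusTransferMatrix` / `wilsonTorusTransferMatrix_hasDerivAt_log_norm` — the
  UNCONDITIONAL instance for the tree's named object, Lüscher's transfer matrix
  `wilsonTorusTransferMatrix ρ β L` of Wilson's theory on the spatial torus `(ℤ/L)³`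
  (`WilsonTorusTransferMatrix.lean`: kernel `wilsonSliceKernel ρ β = e^{−c_{β,L}} · sliceKernel ρ β β`,
  self-adjoint, compact, positivity improving, non-zero, and POSITIVE for `β ≥ 0` by Osterwalder–Seiler /
  Lüscher reflection positivity — all tree theorems): `β ↦ 𝕋_{β,L}` is differentiable IN OPERATOR NORM at
  every `β₀` (`𝕋′ = −c′ 𝕋_{β₀} + e^{−c_{β₀}} S′`, `S′` the isotropic derivative-kernel operator), and for
  `β₀ > 0`, with `φ` the Perron–Jentzsch vector of `𝕋_{β₀,L}`, `β ↦ log ‖𝕋_{β,L}‖ = log λ₀(β)` is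
  DIFFERENTIABLE at `β₀` with derivative `⟪φ, 𝕋′φ⟫/‖𝕋_{β₀,L}‖`, enclosed for every `h > 0` by the chords
  `(log λ₀(β₀) − log λ₀(β₀−h))/h ≤ · ≤ (log λ₀(β₀+h) − log λ₀(β₀))/h`. No hypothesis beyond `ρ` continuous
  unitary and `β₀ > 0` remains.

HONEST FRAMING: finite spatial torus `(ℤ/L)^d`, compact `G`, continuous (for the end-to-end statements:
unitary) `ρ`, any real couplings; pure operator theory about ONE transfer operator family. Nothing about
`L → ∞`, the time direction, the continuum, or a mass gap. The positivity hypothesis `S J ⪰ 0` near `J₀` is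
the Osterwalder–Seiler reflection positivity of the transfer matrix (in the tree for the isotropic torus
kernel, `WilsonTorusTransferMatrix.isPositive_wilsonTorusTransferMatrix`, `β ≥ 0`, which the last section
USES); it is NOT re-proved here. For the torus section: one spatial torus `(ℤ/L)³`, fixed `L`; `λ₀` is the
vacuum eigenvalue of ONE transfer matrix as a function of the bare coupling, not a gap.

## Mathlib / tree search

Tree: `SlabTransferKernel` (`sliceKernel`, `continuous_sliceKernel`, `sliceKernel_pos`, `sliceKernel_symm`,
`continuous_elecSum`, `continuous_magSum`), `SliceKernelHellmannFeynman` (`hasDerivAt_sliceKernel_elec/_mag`,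
weak Hellmann–Feynman), `SliceKernelLogConvex` (`convexOn_log_norm_sliceKernelOp_elec/_mag`),
`PositiveKernelTransferOperator` (`isSelfAdjoint_/isCompactOperator_/isPositivityImproving_kernelOp`,
`kernelOp_ne_zero`), `KernelFamilyOperatorDerivative`, `TopEigenvalueDerivativeGap`, `WilsonTorusTransferMatrix`
(`wilsonTorusTransferMatrix_ae_eq`, `inner_wilsonTorusTransferMatrix_self_nonneg`, `wilsonTorusTransferMatrix_ne_zero`,
`wilsonSliceKernel_eq_mul_sliceKernel`). Nothing on
operator-norm differentiability of transfer operators (`lean search 'hasDerivAt.*[Tt]ransfer|hasDerivAt_sliceKernelOp'`).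

## References

* T. Kato, *Perturbation Theory for Linear Operators* (1966), II-§5.4 Thm 5.4, VIII-§2.3 Thm 2.6 (m = 1).
  [Kato1966]
* K. Osterwalder, E. Seiler, Ann. Phys. 110 (1978) 440, §§2–3 (transfer matrix of lattice gauge theory).
  [OsterwalderSeiler1978]
* M. Reed, B. Simon, *Methods of Modern Mathematical Physics IV*, Thms XIII.43–44. [ReedSimonIV1978]
* M. Lüscher, *Construction of a selfadjoint, strictly positive transfer matrix for Euclidean lattice gauge
  theories*, Commun. Math. Phys. 54 (1977) 283. [Luscher1977]
* I. Montvay, G. Münster, *Quantum Fields on a Lattice* (1994), §3.2.6 (3.137)–(3.146). [MontvayMunster1994]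
-/

noncomputable section

open MeasureTheory Set Filter Function Topology Metric
open scoped RealInnerProductSpace ENNReal

namespace Literature.MathematicalPhysics.QuantumFieldTheory

open Literature.Analysis.OperatorTheory

/-! ### A continuity lemma: fibre integrals of jointly continuous functions on compact spaces -/

section Fibre

/-- **Continuity of fibre integrals**: for `F` jointly continuous on `P × Y` with `P`, `Y` compact
(`P` first countable) and `ν` a finite measure on `Y`, `p ↦ ∫ F(p, y) dν(y)` is continuous (dominated
convergence with the global sup bound). [folklore] -/
private theorem continuous_integral_fibre {P Y : Type*} [TopologicalSpace P] [CompactSpace P]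
    [FirstCountableTopology P] [TopologicalSpace Y] [CompactSpace Y] [MeasurableSpace Y]
    [OpensMeasurableSpace Y] {ν : Measure Y} [IsFiniteMeasure ν] {F : P × Y → ℝ}
    (hF : Continuous F) : Continuous fun p : P => ∫ y, F (p, y) ∂ν := by
  obtain ⟨B, hB⟩ := isCompact_univ.exists_bound_of_continuousOn hF.continuousOn
  refine continuous_of_dominated (F := fun (p : P) (y : Y) => F (p, y)) (bound := fun _ => B)
    (fun p => ?_) (fun p => Eventually.of_forall fun y => hB (p, y) (mem_univ _))
    (integrable_const B) (Eventually.of_forall fun y => ?_)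
  · exact (hF.comp (Continuous.prodMk continuous_const continuous_id)).aestronglyMeasurable
  · exact hF.comp (Continuous.prodMk continuous_id continuous_const)

end Fibre

section Slice

variable {d L : ℕ} {G : Type*} [Group G] [TopologicalSpace G] [IsTopologicalGroup G] [CompactSpace G]
  [MeasurableSpace G] [BorelSpace G] {N : ℕ} (ρ : G →* Matrix (Fin N) (Fin N) ℂ)
  [SecondCountableTopology G]

/-! ### Uniform bounds on the plaquette sums -/

omit [MeasurableSpace G] [BorelSpace G] [SecondCountableTopology G] in
/-- `|elecSum ρ a E b| ≤ M` uniformly (continuous function on a compact space). [folklore] -/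
private theorem exists_abs_elecSum_le' [NeZero L] (hρ : Continuous ρ) :
    ∃ M : ℝ, ∀ (a : (Fin d → ZMod L) × Fin d → G) (E : (Fin d → ZMod L) → G)
      (b : (Fin d → ZMod L) × Fin d → G), |elecSum ρ a E b| ≤ M := by
  obtain ⟨M, hM⟩ := isCompact_univ.exists_bound_of_continuousOn
    (continuous_elecSum (d := d) (L := L) ρ hρ).continuousOn
  exact ⟨M, fun a E b => by simpa [Real.norm_eq_abs] using hM ((a, b), E) (mem_univ _)⟩

omit [MeasurableSpace G] [BorelSpace G] [SecondCountableTopology G] in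
/-- `|magSum ρ a| ≤ M` uniformly. [folklore] -/
private theorem exists_abs_magSum_le' [NeZero L] (hρ : Continuous ρ) :
    ∃ M : ℝ, ∀ a : (Fin d → ZMod L) × Fin d → G, |magSum ρ a| ≤ M := by
  obtain ⟨M, hM⟩ := isCompact_univ.exists_bound_of_continuousOn
    (continuous_magSum (d := d) (L := L) ρ hρ).continuousOn
  exact ⟨M, fun a => by simpa [Real.norm_eq_abs] using hM a (mem_univ _)⟩

/-- `(a, b) ↦ ∫ e^{J q(a,E,b)} q(a,E,b)ⁿ dE` is jointly continuous. [folklore] -/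
private theorem continuous_integral_exp_mul_elecSum_pow [NeZero L] (hρ : Continuous ρ) (J : ℝ) (n : ℕ) :
    Continuous fun p : ((Fin d → ZMod L) × Fin d → G) × ((Fin d → ZMod L) × Fin d → G) =>
      ∫ E, Real.exp (J * elecSum ρ p.1 E p.2) * elecSum ρ p.1 E p.2 ^ n
        ∂(Measure.pi fun _ : Fin d → ZMod L => haarProbability G) := by
  have hq := continuous_elecSum (d := d) (L := L) ρ hρ
  exact continuous_integral_fibre (ν := Measure.pi fun _ : Fin d → ZMod L => haarProbability G)
    ((Real.continuous_exp.comp (continuous_const.mul hq)).mul (hq.pow n))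

/-! ### Operator-norm differentiability in the electric coupling -/

variable {μ : Measure ((Fin d → ZMod L) × Fin d → G)} [IsFiniteMeasure μ]

/-- ★ **The slice transfer operators are differentiable in the electric coupling, in operator norm.**
Let `S J_E` (`J_E ∈ ℝ`) be bounded operators on `L²(μ)` given a.e. by the kernels `sliceKernel ρ J_E J_M`
(`J_M` fixed) and `S′` an operator given a.e. by the electric derivative kernel at `J₀`
(`e^{J_M m(a)/2} (∫ e^{J₀ q} q dE) e^{J_M m(b)/2}`, which exists: `exists_sliceKernelElecOp`). Then
`HasDerivAt S S′ J₀` in the operator norm of `L²(μ) →L L²(μ)`. [cite: Kato1966, II-§5.4 Theorem 5.4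
(differentiability at a point, operator-valued o(ϰ))] [cite: OsterwalderSeiler1978, §2–3 (transfer kernel)] -/
theorem hasDerivAt_sliceKernelOp_elec [NeZero L] (hρ : Continuous ρ) (JM J₀ : ℝ)
    {S : ℝ → Lp ℝ 2 μ →L[ℝ] Lp ℝ 2 μ} {S' : Lp ℝ 2 μ →L[ℝ] Lp ℝ 2 μ}
    (hS : ∀ JE : ℝ, ∀ φ : Lp ℝ 2 μ, (S JE φ : ((Fin d → ZMod L) × Fin d → G) → ℝ) =ᵐ[μ]
      fun a => ∫ b, sliceKernel ρ JE JM a b * φ b ∂μ)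
    (hS' : ∀ φ : Lp ℝ 2 μ, (S' φ : ((Fin d → ZMod L) × Fin d → G) → ℝ) =ᵐ[μ]
      fun a => ∫ b, (Real.exp (JM / 2 * magSum ρ a) *
        (∫ E, Real.exp (J₀ * elecSum ρ a E b) * elecSum ρ a E b
          ∂(Measure.pi fun _ : Fin d → ZMod L => haarProbability G)) *
        Real.exp (JM / 2 * magSum ρ b)) * φ b ∂μ) :
    HasDerivAt S S' J₀ := by
  obtain ⟨M, hM⟩ := exists_abs_elecSum_le' (d := d) (L := L) ρ hρ
  obtain ⟨Mm, hMm⟩ := exists_abs_magSum_le' (d := d) (L := L) ρ hρ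
  have hM0 : 0 ≤ M := (abs_nonneg _).trans (hM 1 1 1)
  -- exponential prefactor bound
  have hem : ∀ a : (Fin d → ZMod L) × Fin d → G,
      |Real.exp (JM / 2 * magSum ρ a)| ≤ Real.exp (|JM| / 2 * Mm) := fun a => by
    rw [Real.abs_exp]
    refine Real.exp_le_exp.mpr ?_
    calc JM / 2 * magSum ρ a ≤ |JM / 2 * magSum ρ a| := le_abs_self _
      _ = |JM| / 2 * |magSum ρ a| := by rw [abs_mul, abs_div, abs_two]
      _ ≤ |JM| / 2 * Mm := mul_le_mul_of_nonneg_left (hMm a) (by positivity)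
  -- measurability of `q = elecSum ρ a · b`
  have hqm : ∀ a b : (Fin d → ZMod L) × Fin d → G,
      AEStronglyMeasurable (fun E : (Fin d → ZMod L) → G => elecSum ρ a E b)
        (Measure.pi fun _ : Fin d → ZMod L => haarProbability G) := fun a b =>
    ((continuous_elecSum (d := d) (L := L) ρ hρ).comp
      (Continuous.prodMk (continuous_const (y := (a, b))) continuous_id)).aestronglyMeasurable
  -- bounds on `∫ e^{Jq} qⁿ` for `|J| ≤ |J₀| + 1`
  have hI : ∀ (n : ℕ) (J : ℝ), J ∈ Icc (J₀ - 1) (J₀ + 1) → ∀ a b : (Fin d → ZMod L) × Fin d → G,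
      |∫ E, Real.exp (J * elecSum ρ a E b) * elecSum ρ a E b ^ n
          ∂(Measure.pi fun _ : Fin d → ZMod L => haarProbability G)| ≤
        Real.exp ((|J₀| + 1) * M) * M ^ n := by
    intro n J hJ a b
    have hJ' : |J| ≤ |J₀| + 1 := by
      rcases hJ with ⟨h1, h2⟩
      rw [abs_le]; constructor <;> [linarith [neg_abs_le J₀]; linarith [le_abs_self J₀]]
    have h := abs_integral_exp_mul_pow_le (ν := Measure.pi fun _ : Fin d → ZMod L => haarProbability G)
      (q := fun E => elecSum ρ a E b) (fun E => hM a E b) n J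
    refine h.trans ?_
    rw [probReal_univ, mul_one]
    exact mul_le_mul_of_nonneg_right (Real.exp_le_exp.mpr
      (mul_le_mul_of_nonneg_right hJ' hM0)) (pow_nonneg hM0 n)
  refine hasDerivAt_kernelOp_of_abs_deriv_two_le (μ := μ) (K := fun J => sliceKernel ρ J JM)
    (dK := fun J a b => Real.exp (JM / 2 * magSum ρ a) *
      (∫ E, Real.exp (J * elecSum ρ a E b) * elecSum ρ a E b
        ∂(Measure.pi fun _ : Fin d → ZMod L => haarProbability G)) * Real.exp (JM / 2 * magSum ρ b))
    (d2K := fun J a b => Real.exp (JM / 2 * magSum ρ a) *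
      (∫ E, Real.exp (J * elecSum ρ a E b) * elecSum ρ a E b ^ 2
        ∂(Measure.pi fun _ : Fin d → ZMod L => haarProbability G)) * Real.exp (JM / 2 * magSum ρ b))
    (t₀ := J₀) (r := 1) one_pos
    (C := Real.exp (|JM| / 2 * Mm) * Real.exp ((|J₀| + 1) * M) * Real.exp (|JM| / 2 * Mm))
    (C' := Real.exp (|JM| / 2 * Mm) * (Real.exp ((|J₀| + 1) * M) * M) * Real.exp (|JM| / 2 * Mm))
    (R := Real.exp (|JM| / 2 * Mm) * (Real.exp ((|J₀| + 1) * M) * M ^ 2) * Real.exp (|JM| / 2 * Mm))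
    (fun J _ => (continuous_sliceKernel (d := d) (L := L) ρ hρ J JM).stronglyMeasurable)
    (fun J hJ a b => ?_) ?_ (fun a b => ?_) (fun J _ a b => hasDerivAt_sliceKernel_elec ρ hρ JM J a b)
    (fun J _ a b => ?_) (fun J hJ a b => ?_) (fun J _ => hS J) hS'
  · -- bound of the kernel on the interval
    rw [Real.norm_eq_abs]
    unfold sliceKernel
    rw [abs_mul, abs_mul]
    have h0 := hI 0 J hJ a b
    simp only [pow_zero, mul_one] at h0
    exact mul_le_mul (mul_le_mul (hem a) h0 (abs_nonneg _) (Real.exp_pos _).le) (hem b)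
      (abs_nonneg _) (mul_nonneg (Real.exp_pos _).le (Real.exp_pos _).le)
  · -- joint measurability of the derivative kernel at `J₀` (continuity)
    have hm := continuous_magSum (d := d) (L := L) ρ hρ
    have hI1 := continuous_integral_exp_mul_elecSum_pow (d := d) (L := L) ρ hρ J₀ 1
    simp only [pow_one] at hI1
    exact (((Real.continuous_exp.comp (continuous_const.mul (hm.comp continuous_fst))).mul hI1).mul
      (Real.continuous_exp.comp (continuous_const.mul (hm.comp continuous_snd)))).stronglyMeasurable
  · -- bound of the derivative kernel at `J₀`
    rw [Real.norm_eq_abs, abs_mul, abs_mul]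
    have h1 := hI 1 J₀ ⟨by linarith, by linarith⟩ a b
    simp only [pow_one] at h1
    exact mul_le_mul (mul_le_mul (hem a) h1 (abs_nonneg _) (Real.exp_pos _).le) (hem b)
      (abs_nonneg _) (mul_nonneg (Real.exp_pos _).le (mul_nonneg (Real.exp_pos _).le hM0))
  · -- second derivative
    have h := hasDerivAt_integral_exp_mul_pow
      (ν := Measure.pi fun _ : Fin d → ZMod L => haarProbability G) (hqm a b) (fun E => hM a E b) 1 J
    simp only [pow_one] at h
    exact (h.const_mul _).mul_const _
  · -- bound of the second derivative on the interval
    rw [abs_mul, abs_mul]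
    exact mul_le_mul (mul_le_mul (hem a) (hI 2 J hJ a b) (abs_nonneg _) (Real.exp_pos _).le) (hem b)
      (abs_nonneg _) (mul_nonneg (Real.exp_pos _).le (mul_nonneg (Real.exp_pos _).le (pow_nonneg hM0 2)))

/-! ### Operator-norm differentiability in the magnetic coupling -/

/-- ★ **The slice transfer operators are differentiable in the magnetic coupling, in operator norm.**
Let `S J_M` be bounded operators on `L²(μ)` given a.e. by the kernels `sliceKernel ρ J_E J_M` (`J_E`
fixed) and `S′` an operator given a.e. by the magnetic derivative kernel
`sliceKernel ρ J_E J₀ a b · (m(a) + m(b))/2` at `J₀` (exists: `exists_sliceKernelMagOp`). Then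
`HasDerivAt S S′ J₀` in operator norm. [cite: Kato1966, II-§5.4 Theorem 5.4 (differentiability at a
point, operator-valued o(ϰ))] [cite: OsterwalderSeiler1978, §2–3 (transfer kernel)] -/
theorem hasDerivAt_sliceKernelOp_mag [NeZero L] (hρ : Continuous ρ) (JE J₀ : ℝ)
    {S : ℝ → Lp ℝ 2 μ →L[ℝ] Lp ℝ 2 μ} {S' : Lp ℝ 2 μ →L[ℝ] Lp ℝ 2 μ}
    (hS : ∀ JM : ℝ, ∀ φ : Lp ℝ 2 μ, (S JM φ : ((Fin d → ZMod L) × Fin d → G) → ℝ) =ᵐ[μ]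
      fun a => ∫ b, sliceKernel ρ JE JM a b * φ b ∂μ)
    (hS' : ∀ φ : Lp ℝ 2 μ, (S' φ : ((Fin d → ZMod L) × Fin d → G) → ℝ) =ᵐ[μ]
      fun a => ∫ b, (sliceKernel ρ JE J₀ a b * ((magSum ρ a + magSum ρ b) / 2)) * φ b ∂μ) :
    HasDerivAt S S' J₀ := by
  obtain ⟨M, hM⟩ := exists_abs_elecSum_le' (d := d) (L := L) ρ hρ
  obtain ⟨Mm, hMm⟩ := exists_abs_magSum_le' (d := d) (L := L) ρ hρ
  have hM0 : 0 ≤ M := (abs_nonneg _).trans (hM 1 1 1)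
  have hMm0 : 0 ≤ Mm := (abs_nonneg _).trans (hMm 1)
  -- `c(a,b) = (m(a) + m(b))/2`, `|c| ≤ Mm`
  have hc : ∀ a b : (Fin d → ZMod L) × Fin d → G, |(magSum ρ a + magSum ρ b) / 2| ≤ Mm := by
    intro a b
    rw [abs_div, abs_two, div_le_iff₀ (by norm_num : (0:ℝ) < 2)]
    exact (abs_add_le _ _).trans (by linarith [hMm a, hMm b])
  -- uniform bound of the slice kernel for `J_M ∈ [J₀ - 1, J₀ + 1]`
  have hem : ∀ (J : ℝ), J ∈ Icc (J₀ - 1) (J₀ + 1) → ∀ a : (Fin d → ZMod L) × Fin d → G,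
      |Real.exp (J / 2 * magSum ρ a)| ≤ Real.exp ((|J₀| + 1) / 2 * Mm) := by
    intro J hJ a
    have hJ' : |J| ≤ |J₀| + 1 := by
      rcases hJ with ⟨h1, h2⟩
      rw [abs_le]; constructor <;> [linarith [neg_abs_le J₀]; linarith [le_abs_self J₀]]
    rw [Real.abs_exp]
    refine Real.exp_le_exp.mpr ?_
    calc J / 2 * magSum ρ a ≤ |J / 2 * magSum ρ a| := le_abs_self _
      _ = |J| / 2 * |magSum ρ a| := by rw [abs_mul, abs_div, abs_two]
      _ ≤ (|J₀| + 1) / 2 * Mm := mul_le_mul (by linarith) (hMm a) (abs_nonneg _) (by positivity)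
  have hI0 : ∀ a b : (Fin d → ZMod L) × Fin d → G,
      |∫ E, Real.exp (JE * elecSum ρ a E b) ∂(Measure.pi fun _ : Fin d → ZMod L => haarProbability G)| ≤
        Real.exp (|JE| * M) := by
    intro a b
    have h := abs_integral_exp_mul_pow_le (ν := Measure.pi fun _ : Fin d → ZMod L => haarProbability G)
      (q := fun E => elecSum ρ a E b) (fun E => hM a E b) 0 JE
    simp only [pow_zero, mul_one] at h
    rwa [probReal_univ, mul_one] at h
  have hKb : ∀ (J : ℝ), J ∈ Icc (J₀ - 1) (J₀ + 1) → ∀ a b : (Fin d → ZMod L) × Fin d → G,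
      |sliceKernel ρ JE J a b| ≤
        Real.exp ((|J₀| + 1) / 2 * Mm) * Real.exp (|JE| * M) * Real.exp ((|J₀| + 1) / 2 * Mm) := by
    intro J hJ a b
    unfold sliceKernel
    rw [abs_mul, abs_mul]
    exact mul_le_mul (mul_le_mul (hem J hJ a) (hI0 a b) (abs_nonneg _) (Real.exp_pos _).le) (hem J hJ b)
      (abs_nonneg _) (mul_nonneg (Real.exp_pos _).le (Real.exp_pos _).le)
  set B : ℝ := Real.exp ((|J₀| + 1) / 2 * Mm) * Real.exp (|JE| * M) * Real.exp ((|J₀| + 1) / 2 * Mm)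
    with hB
  refine hasDerivAt_kernelOp_of_abs_deriv_two_le (μ := μ) (K := fun J => sliceKernel ρ JE J)
    (dK := fun J a b => sliceKernel ρ JE J a b * ((magSum ρ a + magSum ρ b) / 2))
    (d2K := fun J a b => sliceKernel ρ JE J a b * ((magSum ρ a + magSum ρ b) / 2) *
      ((magSum ρ a + magSum ρ b) / 2))
    (t₀ := J₀) (r := 1) one_pos (C := B) (C' := B * Mm) (R := B * Mm * Mm)
    (fun J _ => (continuous_sliceKernel (d := d) (L := L) ρ hρ JE J).stronglyMeasurable)
    (fun J hJ a b => by rw [Real.norm_eq_abs]; exact hKb J hJ a b) ?_ (fun a b => ?_)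
    (fun J _ a b => hasDerivAt_sliceKernel_mag ρ JE J a b)
    (fun J _ a b => (hasDerivAt_sliceKernel_mag ρ JE J a b).mul_const _)
    (fun J hJ a b => ?_) (fun J _ => hS J) hS'
  · -- measurability of the derivative kernel
    have hm := continuous_magSum (d := d) (L := L) ρ hρ
    have hk := continuous_sliceKernel (d := d) (L := L) ρ hρ JE J₀
    have e : uncurry (fun a b => sliceKernel ρ JE J₀ a b * ((magSum ρ a + magSum ρ b) / 2)) =
        fun p : ((Fin d → ZMod L) × Fin d → G) × ((Fin d → ZMod L) × Fin d → G) =>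
          uncurry (sliceKernel (d := d) (L := L) ρ JE J₀) p *
            ((magSum ρ p.1 + magSum ρ p.2) / 2) := by
      funext p; rfl
    rw [e]
    exact (hk.mul (((hm.comp continuous_fst).add (hm.comp continuous_snd)).div_const _)).stronglyMeasurable
  · -- bound of the derivative kernel at `J₀`
    rw [Real.norm_eq_abs, abs_mul]
    exact mul_le_mul (hKb J₀ ⟨by linarith, by linarith⟩ a b) (hc a b) (abs_nonneg _)
      (by rw [hB]; positivity)
  · -- bound of the second derivative
    rw [abs_mul, abs_mul]
    exact mul_le_mul (mul_le_mul (hKb J hJ a b) (hc a b) (abs_nonneg _) (by rw [hB]; positivity))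
      (hc a b) (abs_nonneg _) (by rw [hB]; positivity)

/-! ### End to end: `∂ log λ₀` exists, is the Hellmann–Feynman value, and lies in the secant bracket -/

/-- ★★ **Electric coupling, end to end.** Let `ρ` be continuous and unitary, `μ ≠ 0` a finite measure
on the spatial link configurations, `S J_E` bounded operators on `L²(μ)` with the kernels
`sliceKernel ρ J_E J_M`, `S′` an operator with the electric derivative kernel at `J₀`, and suppose
`S J_E ⪰ 0` for `J_E` near `J₀` (reflection positivity). Then there is a unit, a.e. strictly positive
`φ` with `S J₀ φ = ‖S J₀‖ φ` (Perron–Jentzsch vector) such that `J_E ↦ log ‖S J_E‖` is DIFFERENTIABLE at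
`J₀` with derivative `⟪φ, S′φ⟫/‖S J₀‖`, and for every `h > 0`
`(log‖S J₀‖ - log‖S (J₀-h)‖)/h ≤ ⟪φ, S′φ⟫/‖S J₀‖ ≤ (log‖S (J₀+h)‖ - log‖S J₀‖)/h`.
[cite: Kato1966, VIII-§2.3 Theorem 2.6 (2.17) (case m = 1)] [cite: ReedSimonIV1978, Thm XIII.43 and
Thm XIII.44] [cite: OsterwalderSeiler1978, §2–3] -/
theorem exists_hasDerivAt_log_norm_sliceKernelOp_elec [NeZero L] (hρ : Continuous ρ)
    (hρu : ∀ g, ρ g ∈ Matrix.unitaryGroup (Fin N) ℂ) (hμ : μ ≠ 0) (JM J₀ : ℝ)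
    {S : ℝ → Lp ℝ 2 μ →L[ℝ] Lp ℝ 2 μ} {S' : Lp ℝ 2 μ →L[ℝ] Lp ℝ 2 μ}
    (hS : ∀ JE : ℝ, ∀ φ : Lp ℝ 2 μ, (S JE φ : ((Fin d → ZMod L) × Fin d → G) → ℝ) =ᵐ[μ]
      fun a => ∫ b, sliceKernel ρ JE JM a b * φ b ∂μ)
    (hS' : ∀ φ : Lp ℝ 2 μ, (S' φ : ((Fin d → ZMod L) × Fin d → G) → ℝ) =ᵐ[μ]
      fun a => ∫ b, (Real.exp (JM / 2 * magSum ρ a) *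
        (∫ E, Real.exp (J₀ * elecSum ρ a E b) * elecSum ρ a E b
          ∂(Measure.pi fun _ : Fin d → ZMod L => haarProbability G)) *
        Real.exp (JM / 2 * magSum ρ b)) * φ b ∂μ)
    (hpsd : ∀ᶠ JE in 𝓝 J₀, ∀ φ : Lp ℝ 2 μ, 0 ≤ ⟪φ, S JE φ⟫) :
    ∃ φ : Lp ℝ 2 μ, ‖φ‖ = 1 ∧ IsStrictlyPositiveFun φ ∧ S J₀ φ = ‖S J₀‖ • φ ∧
      HasDerivAt (fun JE => Real.log ‖S JE‖) (⟪φ, S' φ⟫ / ‖S J₀‖) J₀ ∧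
      ∀ h : ℝ, 0 < h →
        (Real.log ‖S J₀‖ - Real.log ‖S (J₀ - h)‖) / h ≤ ⟪φ, S' φ⟫ / ‖S J₀‖ ∧
        ⟪φ, S' φ⟫ / ‖S J₀‖ ≤ (Real.log ‖S (J₀ + h)‖ - Real.log ‖S J₀‖) / h := by
  have hd := hasDerivAt_sliceKernelOp_elec (μ := μ) ρ hρ JM J₀ hS hS'
  -- self-adjointness (symmetric kernel), compactness, positivity improvement, non-vanishing
  have hsa : ∀ᶠ JE in 𝓝 J₀, IsSelfAdjoint (S JE) := Eventually.of_forall fun JE => by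
    obtain ⟨C, hC⟩ := exists_sliceKernel_le (d := d) (L := L) ρ hρ JE JM
    exact isSelfAdjoint_kernelOp (continuous_sliceKernel (d := d) (L := L) ρ hρ JE JM).stronglyMeasurable hC
      (sliceKernel_symm ρ hρu JE JM) (hS JE)
  obtain ⟨C₀, hC₀⟩ := exists_sliceKernel_le (d := d) (L := L) ρ hρ J₀ JM
  have hC₀0 : 0 ≤ C₀ := (norm_nonneg _).trans (hC₀ 1 1)
  have hc : IsCompactOperator (S J₀) := isCompactOperator_kernelOp hC₀ hC₀0 (hS J₀)
  have hImp : IsPositivityImproving (S J₀) :=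
    isPositivityImproving_kernelOp (continuous_sliceKernel (d := d) (L := L) ρ hρ J₀ JM).stronglyMeasurable
      hC₀ (sliceKernel_pos (d := d) (L := L) ρ hρ J₀ JM) (hS J₀)
  have h0 : S J₀ ≠ 0 :=
    kernelOp_ne_zero (continuous_sliceKernel (d := d) (L := L) ρ hρ J₀ JM).stronglyMeasurable hC₀
      (sliceKernel_pos (d := d) (L := L) ρ hρ J₀ JM) hμ (hS J₀)
  obtain ⟨φ, hφ1, hφpos, hSφ, hder⟩ :=
    IsPositivityImproving.exists_hasDerivAt_log_opNorm S hd hsa hpsd hImp hc h0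
  refine ⟨φ, hφ1, hφpos, hSφ, hder, fun h hh => ?_⟩
  -- the bracket (Kingman convexity + the weak Hellmann–Feynman derivative)
  have hconv := (convexOn_log_norm_sliceKernelOp_elec (μ := μ) ρ hρ hμ JM hS).subset
    (subset_univ (Icc (J₀ - h) (J₀ + h))) (convex_Icc _ _)
  have htop : ⟪φ, S J₀ φ⟫ = ‖S J₀‖ := by
    rw [hSφ, real_inner_smul_right, real_inner_self_eq_norm_sq, hφ1, one_pow, mul_one]
  have hg := hasDerivAt_inner_sliceKernelOp_elec (μ := μ) ρ hρ JM J₀ hS hS' φ φ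
  exact log_norm_secant_bracket S hh hconv hφ1 htop (norm_pos_iff.2 h0) hg

/-- ★★ **Magnetic coupling, end to end**: same as `exists_hasDerivAt_log_norm_sliceKernelOp_elec` for
`J_M ↦ S J_M` (kernels `sliceKernel ρ J_E J_M`, `J_E` fixed) with the magnetic derivative kernel.
[cite: Kato1966, VIII-§2.3 Theorem 2.6 (2.17) (case m = 1)] [cite: ReedSimonIV1978, Thm XIII.43 and
Thm XIII.44] [cite: OsterwalderSeiler1978, §2–3] -/
theorem exists_hasDerivAt_log_norm_sliceKernelOp_mag [NeZero L] (hρ : Continuous ρ)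
    (hρu : ∀ g, ρ g ∈ Matrix.unitaryGroup (Fin N) ℂ) (hμ : μ ≠ 0) (JE J₀ : ℝ)
    {S : ℝ → Lp ℝ 2 μ →L[ℝ] Lp ℝ 2 μ} {S' : Lp ℝ 2 μ →L[ℝ] Lp ℝ 2 μ}
    (hS : ∀ JM : ℝ, ∀ φ : Lp ℝ 2 μ, (S JM φ : ((Fin d → ZMod L) × Fin d → G) → ℝ) =ᵐ[μ]
      fun a => ∫ b, sliceKernel ρ JE JM a b * φ b ∂μ)
    (hS' : ∀ φ : Lp ℝ 2 μ, (S' φ : ((Fin d → ZMod L) × Fin d → G) → ℝ) =ᵐ[μ]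
      fun a => ∫ b, (sliceKernel ρ JE J₀ a b * ((magSum ρ a + magSum ρ b) / 2)) * φ b ∂μ)
    (hpsd : ∀ᶠ JM in 𝓝 J₀, ∀ φ : Lp ℝ 2 μ, 0 ≤ ⟪φ, S JM φ⟫) :
    ∃ φ : Lp ℝ 2 μ, ‖φ‖ = 1 ∧ IsStrictlyPositiveFun φ ∧ S J₀ φ = ‖S J₀‖ • φ ∧
      HasDerivAt (fun JM => Real.log ‖S JM‖) (⟪φ, S' φ⟫ / ‖S J₀‖) J₀ ∧
      ∀ h : ℝ, 0 < h →
        (Real.log ‖S J₀‖ - Real.log ‖S (J₀ - h)‖) / h ≤ ⟪φ, S' φ⟫ / ‖S J₀‖ ∧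
        ⟪φ, S' φ⟫ / ‖S J₀‖ ≤ (Real.log ‖S (J₀ + h)‖ - Real.log ‖S J₀‖) / h := by
  have hd := hasDerivAt_sliceKernelOp_mag (μ := μ) ρ hρ JE J₀ hS hS'
  have hsa : ∀ᶠ JM in 𝓝 J₀, IsSelfAdjoint (S JM) := Eventually.of_forall fun JM => by
    obtain ⟨C, hC⟩ := exists_sliceKernel_le (d := d) (L := L) ρ hρ JE JM
    exact isSelfAdjoint_kernelOp (continuous_sliceKernel (d := d) (L := L) ρ hρ JE JM).stronglyMeasurable hC
      (sliceKernel_symm ρ hρu JE JM) (hS JM)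
  obtain ⟨C₀, hC₀⟩ := exists_sliceKernel_le (d := d) (L := L) ρ hρ JE J₀
  have hC₀0 : 0 ≤ C₀ := (norm_nonneg _).trans (hC₀ 1 1)
  have hc : IsCompactOperator (S J₀) := isCompactOperator_kernelOp hC₀ hC₀0 (hS J₀)
  have hImp : IsPositivityImproving (S J₀) :=
    isPositivityImproving_kernelOp (continuous_sliceKernel (d := d) (L := L) ρ hρ JE J₀).stronglyMeasurable
      hC₀ (sliceKernel_pos (d := d) (L := L) ρ hρ JE J₀) (hS J₀)
  have h0 : S J₀ ≠ 0 :=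
    kernelOp_ne_zero (continuous_sliceKernel (d := d) (L := L) ρ hρ JE J₀).stronglyMeasurable hC₀
      (sliceKernel_pos (d := d) (L := L) ρ hρ JE J₀) hμ (hS J₀)
  obtain ⟨φ, hφ1, hφpos, hSφ, hder⟩ :=
    IsPositivityImproving.exists_hasDerivAt_log_opNorm S hd hsa hpsd hImp hc h0
  refine ⟨φ, hφ1, hφpos, hSφ, hder, fun h hh => ?_⟩
  have hconv := (convexOn_log_norm_sliceKernelOp_mag (μ := μ) ρ hρ hμ JE hS).subset
    (subset_univ (Icc (J₀ - h) (J₀ + h))) (convex_Icc _ _)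
  have htop : ⟪φ, S J₀ φ⟫ = ‖S J₀‖ := by
    rw [hSφ, real_inner_smul_right, real_inner_self_eq_norm_sq, hφ1, one_pow, mul_one]
  have hg := hasDerivAt_inner_sliceKernelOp_mag (μ := μ) ρ hρ JE J₀ hS hS' φ φ
  exact log_norm_secant_bracket S hh hconv hφ1 htop (norm_pos_iff.2 h0) hg

/-! ### The isotropic family `J ↦ sliceKernel ρ J J` (one coupling on every plaquette) -/

/-- **Existence of the isotropic derivative-kernel operator**: the kernel
`e^{J₀ m(a)/2}(∫ e^{J₀ q} q dE)e^{J₀ m(b)/2} + sliceKernel ρ J₀ J₀ a b · (m(a)+m(b))/2` (temporal plus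
symmetrised spatial plaquette insertion) is bounded and jointly continuous, hence has an integral operator
on `L²(μ)`. [cite: OsterwalderSeiler1978, §2–3 (transfer kernel)] -/
theorem exists_sliceKernelIsoDerivOp [NeZero L] (hρ : Continuous ρ) (J₀ : ℝ) :
    ∃ S' : Lp ℝ 2 μ →L[ℝ] Lp ℝ 2 μ, ∀ φ : Lp ℝ 2 μ, (S' φ : ((Fin d → ZMod L) × Fin d → G) → ℝ) =ᵐ[μ]
      fun a => ∫ b, (Real.exp (J₀ / 2 * magSum ρ a) *
          (∫ E, Real.exp (J₀ * elecSum ρ a E b) * elecSum ρ a E b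
            ∂(Measure.pi fun _ : Fin d → ZMod L => haarProbability G)) *
          Real.exp (J₀ / 2 * magSum ρ b) +
        sliceKernel ρ J₀ J₀ a b * ((magSum ρ a + magSum ρ b) / 2)) * φ b ∂μ := by
  have hm := continuous_magSum (d := d) (L := L) ρ hρ
  have hI1 := continuous_integral_exp_mul_elecSum_pow (d := d) (L := L) ρ hρ J₀ 1
  simp only [pow_one] at hI1
  have hk := continuous_sliceKernel (d := d) (L := L) ρ hρ J₀ J₀
  have hc : Continuous fun p : ((Fin d → ZMod L) × Fin d → G) × ((Fin d → ZMod L) × Fin d → G) =>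
      Real.exp (J₀ / 2 * magSum ρ p.1) *
          (∫ E, Real.exp (J₀ * elecSum ρ p.1 E p.2) * elecSum ρ p.1 E p.2
            ∂(Measure.pi fun _ : Fin d → ZMod L => haarProbability G)) *
          Real.exp (J₀ / 2 * magSum ρ p.2) +
        uncurry (sliceKernel (d := d) (L := L) ρ J₀ J₀) p * ((magSum ρ p.1 + magSum ρ p.2) / 2) :=
    (((Real.continuous_exp.comp (continuous_const.mul (hm.comp continuous_fst))).mul hI1).mul
      (Real.continuous_exp.comp (continuous_const.mul (hm.comp continuous_snd)))).add
      (hk.mul (((hm.comp continuous_fst).add (hm.comp continuous_snd)).div_const _))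
  obtain ⟨C, hC⟩ := isCompact_univ.exists_bound_of_continuousOn hc.continuousOn
  exact exists_kernelOp hc.stronglyMeasurable (C := C) (fun a b => hC (a, b) (mem_univ _))

/-- ★ **The isotropic slice transfer operators `J ↦ S J` (kernels `sliceKernel ρ J J`: the same coupling on
temporal and spatial plaquettes — the tube/torus transfer operator family) are differentiable in operator
norm**, with derivative the operator of the kernel
`e^{J₀ m(a)/2}(∫ e^{J₀ q} q dE)e^{J₀ m(b)/2} + sliceKernel ρ J₀ J₀ a b · (m(a)+m(b))/2`.
[cite: Kato1966, II-§5.4 Theorem 5.4 (differentiability at a point, operator-valued o(ϰ))]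
[cite: OsterwalderSeiler1978, §2–3 (transfer kernel)] -/
theorem hasDerivAt_sliceKernelOp_iso [NeZero L] (hρ : Continuous ρ) (J₀ : ℝ)
    {S : ℝ → Lp ℝ 2 μ →L[ℝ] Lp ℝ 2 μ} {S' : Lp ℝ 2 μ →L[ℝ] Lp ℝ 2 μ}
    (hS : ∀ J : ℝ, ∀ φ : Lp ℝ 2 μ, (S J φ : ((Fin d → ZMod L) × Fin d → G) → ℝ) =ᵐ[μ]
      fun a => ∫ b, sliceKernel ρ J J a b * φ b ∂μ)
    (hS' : ∀ φ : Lp ℝ 2 μ, (S' φ : ((Fin d → ZMod L) × Fin d → G) → ℝ) =ᵐ[μ]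
      fun a => ∫ b, (Real.exp (J₀ / 2 * magSum ρ a) *
          (∫ E, Real.exp (J₀ * elecSum ρ a E b) * elecSum ρ a E b
            ∂(Measure.pi fun _ : Fin d → ZMod L => haarProbability G)) *
          Real.exp (J₀ / 2 * magSum ρ b) +
        sliceKernel ρ J₀ J₀ a b * ((magSum ρ a + magSum ρ b) / 2)) * φ b ∂μ) :
    HasDerivAt S S' J₀ := by
  obtain ⟨M, hM⟩ := exists_abs_elecSum_le' (d := d) (L := L) ρ hρ
  obtain ⟨Mm, hMm⟩ := exists_abs_magSum_le' (d := d) (L := L) ρ hρ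
  have hM0 : 0 ≤ M := (abs_nonneg _).trans (hM 1 1 1)
  have hMm0 : 0 ≤ Mm := (abs_nonneg _).trans (hMm 1)
  -- `c(a,b) = (m(a) + m(b))/2`, `|c| ≤ Mm`
  have hc : ∀ a b : (Fin d → ZMod L) × Fin d → G, |(magSum ρ a + magSum ρ b) / 2| ≤ Mm := by
    intro a b
    rw [abs_div, abs_two, div_le_iff₀ (by norm_num : (0:ℝ) < 2)]
    exact (abs_add_le _ _).trans (by linarith [hMm a, hMm b])
  have hJabs : ∀ J : ℝ, J ∈ Icc (J₀ - 1) (J₀ + 1) → |J| ≤ |J₀| + 1 := by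
    rintro J ⟨h1, h2⟩
    rw [abs_le]; constructor <;> [linarith [neg_abs_le J₀]; linarith [le_abs_self J₀]]
  -- `|e^{J c}| ≤ e^{(|J₀|+1) Mm}` and `|e^{J m/2}| ≤ e^{(|J₀|+1)/2 Mm}` on the interval
  have hec : ∀ J : ℝ, J ∈ Icc (J₀ - 1) (J₀ + 1) → ∀ a b : (Fin d → ZMod L) × Fin d → G,
      |Real.exp (J * ((magSum ρ a + magSum ρ b) / 2))| ≤ Real.exp ((|J₀| + 1) * Mm) := by
    intro J hJ a b
    rw [Real.abs_exp]
    refine Real.exp_le_exp.mpr ?_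
    calc J * ((magSum ρ a + magSum ρ b) / 2) ≤ |J * ((magSum ρ a + magSum ρ b) / 2)| := le_abs_self _
      _ = |J| * |(magSum ρ a + magSum ρ b) / 2| := abs_mul _ _
      _ ≤ (|J₀| + 1) * Mm := mul_le_mul (hJabs J hJ) (hc a b) (abs_nonneg _) (by positivity)
  have hem : ∀ J : ℝ, J ∈ Icc (J₀ - 1) (J₀ + 1) → ∀ a : (Fin d → ZMod L) × Fin d → G,
      |Real.exp (J / 2 * magSum ρ a)| ≤ Real.exp ((|J₀| + 1) / 2 * Mm) := by
    intro J hJ a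
    rw [Real.abs_exp]
    refine Real.exp_le_exp.mpr ?_
    calc J / 2 * magSum ρ a ≤ |J / 2 * magSum ρ a| := le_abs_self _
      _ = |J| / 2 * |magSum ρ a| := by rw [abs_mul, abs_div, abs_two]
      _ ≤ (|J₀| + 1) / 2 * Mm := mul_le_mul (by linarith [hJabs J hJ]) (hMm a) (abs_nonneg _)
          (by positivity)
  -- measurability of `q` and bounds on `∫ e^{Jq} qⁿ`
  have hqm : ∀ a b : (Fin d → ZMod L) × Fin d → G,
      AEStronglyMeasurable (fun E : (Fin d → ZMod L) → G => elecSum ρ a E b)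
        (Measure.pi fun _ : Fin d → ZMod L => haarProbability G) := fun a b =>
    ((continuous_elecSum (d := d) (L := L) ρ hρ).comp
      (Continuous.prodMk (continuous_const (y := (a, b))) continuous_id)).aestronglyMeasurable
  have hI : ∀ (n : ℕ) (J : ℝ), J ∈ Icc (J₀ - 1) (J₀ + 1) → ∀ a b : (Fin d → ZMod L) × Fin d → G,
      |∫ E, Real.exp (J * elecSum ρ a E b) * elecSum ρ a E b ^ n
          ∂(Measure.pi fun _ : Fin d → ZMod L => haarProbability G)| ≤
        Real.exp ((|J₀| + 1) * M) * M ^ n := by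
    intro n J hJ a b
    have h := abs_integral_exp_mul_pow_le (ν := Measure.pi fun _ : Fin d → ZMod L => haarProbability G)
      (q := fun E => elecSum ρ a E b) (fun E => hM a E b) n J
    refine h.trans ?_
    rw [probReal_univ, mul_one]
    exact mul_le_mul_of_nonneg_right (Real.exp_le_exp.mpr
      (mul_le_mul_of_nonneg_right (hJabs J hJ) hM0)) (pow_nonneg hM0 n)
  -- the product form `sliceKernel ρ J J a b = (∫ e^{Jq}) e^{J c}`
  have hprod : ∀ (J X : ℝ) (a b : (Fin d → ZMod L) × Fin d → G),
      Real.exp (J / 2 * magSum ρ a) * X * Real.exp (J / 2 * magSum ρ b) =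
        X * Real.exp (J * ((magSum ρ a + magSum ρ b) / 2)) := by
    intro J X a b
    rw [show J * ((magSum ρ a + magSum ρ b) / 2) = J / 2 * magSum ρ a + J / 2 * magSum ρ b by ring,
      Real.exp_add]
    ring
  have hfun : ∀ a b : (Fin d → ZMod L) × Fin d → G, (fun J => sliceKernel ρ J J a b) = fun J =>
      (∫ E, Real.exp (J * elecSum ρ a E b) ∂(Measure.pi fun _ : Fin d → ZMod L => haarProbability G)) *
        Real.exp (J * ((magSum ρ a + magSum ρ b) / 2)) := by
    intro a b; funext J; unfold sliceKernel; exact hprod J _ a b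
  -- constants
  set A : ℝ := Real.exp ((|J₀| + 1) * M) with hA
  set Ec : ℝ := Real.exp ((|J₀| + 1) * Mm) with hEc
  set Eh : ℝ := Real.exp ((|J₀| + 1) / 2 * Mm) with hEh
  refine hasDerivAt_kernelOp_of_abs_deriv_two_le (μ := μ) (K := fun J => sliceKernel ρ J J)
    (dK := fun J a b =>
      (∫ E, Real.exp (J * elecSum ρ a E b) * elecSum ρ a E b
        ∂(Measure.pi fun _ : Fin d → ZMod L => haarProbability G)) *
          Real.exp (J * ((magSum ρ a + magSum ρ b) / 2)) +
      (∫ E, Real.exp (J * elecSum ρ a E b) ∂(Measure.pi fun _ : Fin d → ZMod L => haarProbability G)) *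
          (Real.exp (J * ((magSum ρ a + magSum ρ b) / 2)) * ((magSum ρ a + magSum ρ b) / 2)))
    (d2K := fun J a b =>
      (∫ E, Real.exp (J * elecSum ρ a E b) * elecSum ρ a E b ^ 2
        ∂(Measure.pi fun _ : Fin d → ZMod L => haarProbability G)) *
          Real.exp (J * ((magSum ρ a + magSum ρ b) / 2)) +
      (∫ E, Real.exp (J * elecSum ρ a E b) * elecSum ρ a E b
        ∂(Measure.pi fun _ : Fin d → ZMod L => haarProbability G)) *
          (Real.exp (J * ((magSum ρ a + magSum ρ b) / 2)) * ((magSum ρ a + magSum ρ b) / 2)) +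
      ((∫ E, Real.exp (J * elecSum ρ a E b) * elecSum ρ a E b
        ∂(Measure.pi fun _ : Fin d → ZMod L => haarProbability G)) *
          (Real.exp (J * ((magSum ρ a + magSum ρ b) / 2)) * ((magSum ρ a + magSum ρ b) / 2)) +
       (∫ E, Real.exp (J * elecSum ρ a E b) ∂(Measure.pi fun _ : Fin d → ZMod L => haarProbability G)) *
          (Real.exp (J * ((magSum ρ a + magSum ρ b) / 2)) * ((magSum ρ a + magSum ρ b) / 2) *
            ((magSum ρ a + magSum ρ b) / 2))))
    (t₀ := J₀) (r := 1) one_pos (C := Eh * A * Eh) (C' := A * M * Ec + A * (Ec * Mm))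
    (R := A * M ^ 2 * Ec + A * M * (Ec * Mm) + (A * M * (Ec * Mm) + A * (Ec * Mm * Mm)))
    (fun J _ => (continuous_sliceKernel (d := d) (L := L) ρ hρ J J).stronglyMeasurable)
    (fun J hJ a b => ?_) ?_ (fun a b => ?_) (fun J _ a b => ?_) (fun J _ a b => ?_)
    (fun J hJ a b => ?_) (fun J _ => hS J) (fun φ => ?_)
  · -- bound of the kernel
    rw [Real.norm_eq_abs]
    unfold sliceKernel
    rw [abs_mul, abs_mul]
    have h0 := hI 0 J hJ a b
    simp only [pow_zero, mul_one] at h0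
    exact mul_le_mul (mul_le_mul (hem J hJ a) h0 (abs_nonneg _) (by positivity)) (hem J hJ b)
      (abs_nonneg _) (by positivity)
  · -- measurability of `dK J₀`
    have hm := continuous_magSum (d := d) (L := L) ρ hρ
    have hI1 := continuous_integral_exp_mul_elecSum_pow (d := d) (L := L) ρ hρ J₀ 1
    have hI0 := continuous_integral_exp_mul_elecSum_pow (d := d) (L := L) ρ hρ J₀ 0
    simp only [pow_one] at hI1
    simp only [pow_zero, mul_one] at hI0
    have hcc : Continuous fun p : ((Fin d → ZMod L) × Fin d → G) × ((Fin d → ZMod L) × Fin d → G) =>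
        (magSum ρ p.1 + magSum ρ p.2) / 2 :=
      ((hm.comp continuous_fst).add (hm.comp continuous_snd)).div_const _
    have hee : Continuous fun p : ((Fin d → ZMod L) × Fin d → G) × ((Fin d → ZMod L) × Fin d → G) =>
        Real.exp (J₀ * ((magSum ρ p.1 + magSum ρ p.2) / 2)) :=
      Real.continuous_exp.comp (continuous_const.mul hcc)
    exact ((hI1.mul hee).add (hI0.mul (hee.mul hcc))).stronglyMeasurable
  · -- bound of `dK J₀`
    have hJ0 : J₀ ∈ Icc (J₀ - 1) (J₀ + 1) := ⟨by linarith, by linarith⟩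
    have h1 := hI 1 J₀ hJ0 a b
    have h0 := hI 0 J₀ hJ0 a b
    simp only [pow_one] at h1
    simp only [pow_zero, mul_one] at h0
    rw [Real.norm_eq_abs]
    refine (abs_add_le _ _).trans (add_le_add ?_ ?_)
    · rw [abs_mul]
      exact mul_le_mul h1 (hec J₀ hJ0 a b) (abs_nonneg _) (by positivity)
    · rw [abs_mul, abs_mul]
      exact mul_le_mul h0 (mul_le_mul (hec J₀ hJ0 a b) (hc a b) (abs_nonneg _) (by positivity))
        (by positivity) (by positivity)
  · -- first derivative
    have h0 := hasDerivAt_integral_exp_mul_pow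
      (ν := Measure.pi fun _ : Fin d → ZMod L => haarProbability G) (hqm a b) (fun E => hM a E b) 0 J
    simp only [pow_zero, mul_one, zero_add, pow_one] at h0
    have hE : HasDerivAt (fun J : ℝ => Real.exp (J * ((magSum ρ a + magSum ρ b) / 2)))
        (Real.exp (J * ((magSum ρ a + magSum ρ b) / 2)) * ((magSum ρ a + magSum ρ b) / 2)) J := by
      have := (hasDerivAt_mul_const (x := J) ((magSum ρ a + magSum ρ b) / 2)).exp
      simpa only [one_mul] using this
    have h := h0.mul hE
    rw [hfun a b]
    exact h
  · -- second derivative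
    have h0 := hasDerivAt_integral_exp_mul_pow
      (ν := Measure.pi fun _ : Fin d → ZMod L => haarProbability G) (hqm a b) (fun E => hM a E b) 0 J
    simp only [pow_zero, mul_one, zero_add, pow_one] at h0
    have h1 := hasDerivAt_integral_exp_mul_pow
      (ν := Measure.pi fun _ : Fin d → ZMod L => haarProbability G) (hqm a b) (fun E => hM a E b) 1 J
    simp only [pow_one] at h1
    have hE : HasDerivAt (fun J : ℝ => Real.exp (J * ((magSum ρ a + magSum ρ b) / 2)))
        (Real.exp (J * ((magSum ρ a + magSum ρ b) / 2)) * ((magSum ρ a + magSum ρ b) / 2)) J := by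
      have := (hasDerivAt_mul_const (x := J) ((magSum ρ a + magSum ρ b) / 2)).exp
      simpa only [one_mul] using this
    exact (h1.mul hE).add (h0.mul (hE.mul_const _))
  · -- bound of the second derivative
    have h0 := hI 0 J hJ a b
    have h1 := hI 1 J hJ a b
    have h2 := hI 2 J hJ a b
    simp only [pow_one] at h1
    simp only [pow_zero, mul_one] at h0
    have e1 := hec J hJ a b
    refine (abs_add_le _ _).trans (add_le_add ((abs_add_le _ _).trans (add_le_add ?_ ?_))
      ((abs_add_le _ _).trans (add_le_add ?_ ?_)))
    · rw [abs_mul]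
      exact mul_le_mul h2 e1 (abs_nonneg _) (by positivity)
    · rw [abs_mul, abs_mul]
      exact mul_le_mul h1 (mul_le_mul e1 (hc a b) (abs_nonneg _) (by positivity)) (by positivity)
        (by positivity)
    · rw [abs_mul, abs_mul]
      exact mul_le_mul h1 (mul_le_mul e1 (hc a b) (abs_nonneg _) (by positivity)) (by positivity)
        (by positivity)
    · rw [abs_mul, abs_mul, abs_mul]
      exact mul_le_mul h0 (mul_le_mul (mul_le_mul e1 (hc a b) (abs_nonneg _) (by positivity)) (hc a b)
        (abs_nonneg _) (by positivity)) (by positivity) (by positivity)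
  · -- the derivative kernel of `S'` in product form
    refine (hS' φ).trans (Eventually.of_forall fun a => ?_)
    refine integral_congr_ae (Eventually.of_forall fun b => ?_)
    dsimp only
    unfold sliceKernel
    rw [hprod J₀ _ a b, hprod J₀ _ a b]
    ring

/-- **Log-convexity along the diagonal**: for operators `S J` with the kernels `sliceKernel ρ J J`,
`J ↦ log ‖S J‖` is convex on `ℝ` (Kingman; the diagonal case of `convexOn_log_norm_sliceKernelOp`).
[cite: Kingman1961, Theorem] -/
theorem convexOn_log_norm_sliceKernelOp_iso [NeZero L] (hρ : Continuous ρ) (hμ : μ ≠ 0)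
    {S : ℝ → Lp ℝ 2 μ →L[ℝ] Lp ℝ 2 μ}
    (hS : ∀ J : ℝ, ∀ φ : Lp ℝ 2 μ, (S J φ : ((Fin d → ZMod L) × Fin d → G) → ℝ) =ᵐ[μ]
      fun a => ∫ b, sliceKernel ρ J J a b * φ b ∂μ) :
    ConvexOn ℝ univ (fun J : ℝ => Real.log ‖S J‖) := by
  refine convexOn_log_norm_kernelOp (D := univ) (K := fun J : ℝ => sliceKernel ρ J J)
    (fun J _ => (continuous_sliceKernel (d := d) (L := L) ρ hρ J J).stronglyMeasurable)
    (fun J _ => exists_sliceKernel_le (d := d) (L := L) ρ hρ J J) (fun J _ => sliceKernel_nonneg ρ J J)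
    (fun J _ => hS J) (fun J _ J' _ θ hθ₀ hθ₁ a b => ?_) convex_univ fun J _ => ?_
  · have h := sliceKernel_convexComb_le ρ hρ hθ₀ hθ₁ J J J' J' a b
    simpa only [smul_eq_mul] using h
  · obtain ⟨C, hC⟩ := exists_sliceKernel_le (d := d) (L := L) ρ hρ J J
    exact kernelOp_ne_zero (continuous_sliceKernel (d := d) (L := L) ρ hρ J J).stronglyMeasurable hC
      (sliceKernel_pos (d := d) (L := L) ρ hρ J J) hμ (hS J)

/-- ★★ **Isotropic coupling, end to end** (the tube / torus transfer operator family `J ↦ S J`, kernels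
`sliceKernel ρ J J`): for continuous unitary `ρ`, `μ ≠ 0`, `S′` the isotropic derivative-kernel operator at
`J₀` and `S J ⪰ 0` near `J₀`, there is a Perron–Jentzsch vector `φ` with `J ↦ log ‖S J‖` DIFFERENTIABLE
at `J₀`, derivative `⟪φ, S′φ⟫/‖S J₀‖`, lying between the secant slopes for every `h > 0`.
[cite: Kato1966, VIII-§2.3 Theorem 2.6 (2.17) (case m = 1)] [cite: ReedSimonIV1978, Thm XIII.43 and
Thm XIII.44] [cite: OsterwalderSeiler1978, §2–3] -/
theorem exists_hasDerivAt_log_norm_sliceKernelOp_iso [NeZero L] (hρ : Continuous ρ)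
    (hρu : ∀ g, ρ g ∈ Matrix.unitaryGroup (Fin N) ℂ) (hμ : μ ≠ 0) (J₀ : ℝ)
    {S : ℝ → Lp ℝ 2 μ →L[ℝ] Lp ℝ 2 μ} {S' : Lp ℝ 2 μ →L[ℝ] Lp ℝ 2 μ}
    (hS : ∀ J : ℝ, ∀ φ : Lp ℝ 2 μ, (S J φ : ((Fin d → ZMod L) × Fin d → G) → ℝ) =ᵐ[μ]
      fun a => ∫ b, sliceKernel ρ J J a b * φ b ∂μ)
    (hS' : ∀ φ : Lp ℝ 2 μ, (S' φ : ((Fin d → ZMod L) × Fin d → G) → ℝ) =ᵐ[μ]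
      fun a => ∫ b, (Real.exp (J₀ / 2 * magSum ρ a) *
          (∫ E, Real.exp (J₀ * elecSum ρ a E b) * elecSum ρ a E b
            ∂(Measure.pi fun _ : Fin d → ZMod L => haarProbability G)) *
          Real.exp (J₀ / 2 * magSum ρ b) +
        sliceKernel ρ J₀ J₀ a b * ((magSum ρ a + magSum ρ b) / 2)) * φ b ∂μ)
    (hpsd : ∀ᶠ J in 𝓝 J₀, ∀ φ : Lp ℝ 2 μ, 0 ≤ ⟪φ, S J φ⟫) :
    ∃ φ : Lp ℝ 2 μ, ‖φ‖ = 1 ∧ IsStrictlyPositiveFun φ ∧ S J₀ φ = ‖S J₀‖ • φ ∧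
      HasDerivAt (fun J => Real.log ‖S J‖) (⟪φ, S' φ⟫ / ‖S J₀‖) J₀ ∧
      ∀ h : ℝ, 0 < h →
        (Real.log ‖S J₀‖ - Real.log ‖S (J₀ - h)‖) / h ≤ ⟪φ, S' φ⟫ / ‖S J₀‖ ∧
        ⟪φ, S' φ⟫ / ‖S J₀‖ ≤ (Real.log ‖S (J₀ + h)‖ - Real.log ‖S J₀‖) / h := by
  have hd := hasDerivAt_sliceKernelOp_iso (μ := μ) ρ hρ J₀ hS hS'
  have hsa : ∀ᶠ J in 𝓝 J₀, IsSelfAdjoint (S J) := Eventually.of_forall fun J => by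
    obtain ⟨C, hC⟩ := exists_sliceKernel_le (d := d) (L := L) ρ hρ J J
    exact isSelfAdjoint_kernelOp (continuous_sliceKernel (d := d) (L := L) ρ hρ J J).stronglyMeasurable hC
      (sliceKernel_symm ρ hρu J J) (hS J)
  obtain ⟨C₀, hC₀⟩ := exists_sliceKernel_le (d := d) (L := L) ρ hρ J₀ J₀
  have hC₀0 : 0 ≤ C₀ := (norm_nonneg _).trans (hC₀ 1 1)
  have hc : IsCompactOperator (S J₀) := isCompactOperator_kernelOp hC₀ hC₀0 (hS J₀)
  have hImp : IsPositivityImproving (S J₀) :=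
    isPositivityImproving_kernelOp (continuous_sliceKernel (d := d) (L := L) ρ hρ J₀ J₀).stronglyMeasurable
      hC₀ (sliceKernel_pos (d := d) (L := L) ρ hρ J₀ J₀) (hS J₀)
  have h0 : S J₀ ≠ 0 :=
    kernelOp_ne_zero (continuous_sliceKernel (d := d) (L := L) ρ hρ J₀ J₀).stronglyMeasurable hC₀
      (sliceKernel_pos (d := d) (L := L) ρ hρ J₀ J₀) hμ (hS J₀)
  obtain ⟨φ, hφ1, hφpos, hSφ, hder⟩ :=
    IsPositivityImproving.exists_hasDerivAt_log_opNorm S hd hsa hpsd hImp hc h0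
  refine ⟨φ, hφ1, hφpos, hSφ, hder, fun h hh => ?_⟩
  have hconv := (convexOn_log_norm_sliceKernelOp_iso (μ := μ) ρ hρ hμ hS).subset
    (subset_univ (Icc (J₀ - h) (J₀ + h))) (convex_Icc _ _)
  have htop : ⟪φ, S J₀ φ⟫ = ‖S J₀‖ := by
    rw [hSφ, real_inner_smul_right, real_inner_self_eq_norm_sq, hφ1, one_pow, mul_one]
  exact log_norm_secant_bracket S hh hconv hφ1 htop (norm_pos_iff.2 h0)
    (hasDerivAt_inner_apply S hd φ φ)

end Slice

/-! ### Lüscher's transfer matrix `𝕋_{β,L}` of Wilson's theory on the torus: the unconditional instance -/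

section Torus

variable {G : Type*} [Group G] [TopologicalSpace G] [IsTopologicalGroup G] [CompactSpace G]
  [MeasurableSpace G] [BorelSpace G] [SecondCountableTopology G] {n : ℕ}
  (ρ : G →* Matrix (Fin n) (Fin n) ℂ) (L : ℕ) [NeZero L]

/-- The constant `c_{β,L} = β · κ_L` is linear in `β`: `κ_L = n(|P₃| + 3L³)`. [folklore] -/
private theorem sliceKernelConst_eq_mul (β : ℝ) :
    sliceKernelConst n β L = β * sliceKernelConst n 1 L := by
  unfold sliceKernelConst; ring

/-- **`e^{c_{β,L}} 𝕋_{β,L}` is the integral operator of `sliceKernel ρ β β`** (the tree's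
`wilsonSliceKernel_eq_mul_sliceKernel`, transported to the operators). [cite: MontvayMunster1994, §3.2.6
(3.144)] -/
theorem wilsonTorusTransferMatrix_smul_ae_eq (hρ : Continuous ρ) (β : ℝ)
    (φ : Lp ℝ 2 (Measure.pi fun _ : Edge 3 L => haarProbability G)) :
    ((Real.exp (sliceKernelConst n β L) • wilsonTorusTransferMatrix ρ β L) φ : GaugeConfig 3 L G → ℝ)
      =ᵐ[Measure.pi fun _ : Edge 3 L => haarProbability G]
      fun U => ∫ U', sliceKernel ρ β β U U' * φ U' ∂(Measure.pi fun _ : Edge 3 L => haarProbability G) := by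
  have e : (Real.exp (sliceKernelConst n β L) • wilsonTorusTransferMatrix ρ β L) φ =
      Real.exp (sliceKernelConst n β L) • wilsonTorusTransferMatrix ρ β L φ := rfl
  rw [e]
  filter_upwards [Lp.coeFn_smul (Real.exp (sliceKernelConst n β L)) (wilsonTorusTransferMatrix ρ β L φ),
    wilsonTorusTransferMatrix_ae_eq β L hρ φ] with U hU h
  rw [hU, Pi.smul_apply, h, smul_eq_mul, ← integral_const_mul]
  refine integral_congr_ae (Eventually.of_forall fun U' => ?_)
  dsimp only
  rw [wilsonSliceKernel_eq_mul_sliceKernel, ← mul_assoc, ← mul_assoc, ← Real.exp_add, add_neg_cancel,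
    Real.exp_zero, one_mul]

/-- ★ **Lüscher's transfer matrix is differentiable in the coupling, in operator norm**: for continuous `ρ`
and every `β₀`, `β ↦ 𝕋_{β,L}` has a derivative at `β₀` in `L² →L L²`, namely
`𝕋′ = −κ_L e^{−c_{β₀,L}} S_{β₀} + e^{−c_{β₀,L}} S′` where `S_β = e^{c_{β,L}}𝕋_{β,L}` is the integral operator of
`sliceKernel ρ β β` and `S′` that of the isotropic derivative kernel. [cite: Kato1966, II-§5.4 Theorem 5.4
(differentiability at a point, operator-valued o(ϰ))] [cite: MontvayMunster1994, §3.2.6 (3.144)] -/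
theorem hasDerivAt_wilsonTorusTransferMatrix (hρ : Continuous ρ) (β₀ : ℝ)
    {S' : Lp ℝ 2 (Measure.pi fun _ : Edge 3 L => haarProbability G) →L[ℝ]
      Lp ℝ 2 (Measure.pi fun _ : Edge 3 L => haarProbability G)}
    (hS' : ∀ φ, (S' φ : GaugeConfig 3 L G → ℝ) =ᵐ[Measure.pi fun _ : Edge 3 L => haarProbability G]
      fun a => ∫ b, (Real.exp (β₀ / 2 * magSum ρ a) *
          (∫ E, Real.exp (β₀ * elecSum ρ a E b) * elecSum ρ a E b
            ∂(Measure.pi fun _ : Fin 3 → ZMod L => haarProbability G)) *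
          Real.exp (β₀ / 2 * magSum ρ b) +
        sliceKernel ρ β₀ β₀ a b * ((magSum ρ a + magSum ρ b) / 2)) * φ b
          ∂(Measure.pi fun _ : Edge 3 L => haarProbability G)) :
    HasDerivAt (fun β => wilsonTorusTransferMatrix ρ β L)
      (Real.exp (-sliceKernelConst n β₀ L) • S' +
        (-sliceKernelConst n 1 L * Real.exp (-sliceKernelConst n β₀ L)) •
          (Real.exp (sliceKernelConst n β₀ L) • wilsonTorusTransferMatrix ρ β₀ L)) β₀ := by
  -- the rescaled family `S β = e^{c_β} 𝕋_β` is the isotropic slice-kernel family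
  have hS := hasDerivAt_sliceKernelOp_iso (μ := Measure.pi fun _ : Edge 3 L => haarProbability G) ρ hρ β₀
    (S := fun β => Real.exp (sliceKernelConst n β L) • wilsonTorusTransferMatrix ρ β L)
    (fun β φ => wilsonTorusTransferMatrix_smul_ae_eq ρ L hρ β φ) hS'
  -- the scalar `e^{-c_β}`
  have hc : HasDerivAt (fun β => Real.exp (-sliceKernelConst n β L))
      (-sliceKernelConst n 1 L * Real.exp (-sliceKernelConst n β₀ L)) β₀ := by
    have h1 : HasDerivAt (fun β => -sliceKernelConst n β L) (-sliceKernelConst n 1 L) β₀ := by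
      refine (hasDerivAt_mul_const (-sliceKernelConst n 1 L)).congr_of_eventuallyEq
        (Eventually.of_forall fun β => ?_)
      show -sliceKernelConst n β L = β * -sliceKernelConst n 1 L
      rw [sliceKernelConst_eq_mul L β]; ring
    have h2 := h1.exp
    rw [mul_comm] at h2
    exact h2
  have h := hc.smul hS
  -- `e^{-c_β} • (e^{c_β} • 𝕋_β) = 𝕋_β`
  refine h.congr_of_eventuallyEq (Eventually.of_forall fun β => ?_)
  show wilsonTorusTransferMatrix ρ β L =
    Real.exp (-sliceKernelConst n β L) • (Real.exp (sliceKernelConst n β L) • wilsonTorusTransferMatrix ρ β L)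
  rw [smul_smul, ← Real.exp_add, neg_add_cancel, Real.exp_zero, one_smul]

/-- ★★ **`log λ₀(𝕋_{β,L})` is differentiable in `β > 0` with the Hellmann–Feynman derivative, enclosed by
the secant chords — unconditionally.** For continuous unitary `ρ` and `β₀ > 0` there are: the derivative
`𝕋′` of `β ↦ 𝕋_{β,L}` at `β₀` (operator norm) and a unit, a.e. strictly positive `φ` with
`𝕋_{β₀,L} φ = ‖𝕋_{β₀,L}‖ φ` (Perron–Jentzsch vector; `‖𝕋‖ = λ₀` the vacuum eigenvalue), such that
`β ↦ log ‖𝕋_{β,L}‖` has derivative `⟪φ, 𝕋′φ⟫/‖𝕋_{β₀,L}‖` at `β₀`, and for every `h > 0`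
`(log‖𝕋_{β₀}‖ − log‖𝕋_{β₀−h}‖)/h ≤ ⟪φ, 𝕋′φ⟫/‖𝕋_{β₀}‖ ≤ (log‖𝕋_{β₀+h}‖ − log‖𝕋_{β₀}‖)/h`. Inputs (all tree
theorems): reflection positivity `𝕋_β ⪰ 0` for `β ≥ 0`, Jentzsch's gap, Kingman log-convexity, and the
operator-norm differentiability above. [cite: Kato1966, VIII-§2.3 Theorem 2.6 (2.17) (case m = 1)]
[cite: ReedSimonIV1978, Thm XIII.43 and Thm XIII.44] [cite: Luscher1977] -/
theorem wilsonTorusTransferMatrix_hasDerivAt_log_norm (hρ : Continuous ρ)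
    (hρu : ∀ g, ρ g ∈ Matrix.unitaryGroup (Fin n) ℂ) {β₀ : ℝ} (hβ₀ : 0 < β₀) :
    ∃ (T' : Lp ℝ 2 (Measure.pi fun _ : Edge 3 L => haarProbability G) →L[ℝ]
        Lp ℝ 2 (Measure.pi fun _ : Edge 3 L => haarProbability G))
      (φ : Lp ℝ 2 (Measure.pi fun _ : Edge 3 L => haarProbability G)),
      HasDerivAt (fun β => wilsonTorusTransferMatrix ρ β L) T' β₀ ∧
      ‖φ‖ = 1 ∧ IsStrictlyPositiveFun φ ∧
      wilsonTorusTransferMatrix ρ β₀ L φ = ‖wilsonTorusTransferMatrix ρ β₀ L‖ • φ ∧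
      HasDerivAt (fun β => Real.log ‖wilsonTorusTransferMatrix ρ β L‖)
        (⟪φ, T' φ⟫ / ‖wilsonTorusTransferMatrix ρ β₀ L‖) β₀ ∧
      ∀ h : ℝ, 0 < h →
        (Real.log ‖wilsonTorusTransferMatrix ρ β₀ L‖ -
            Real.log ‖wilsonTorusTransferMatrix ρ (β₀ - h) L‖) / h ≤
          ⟪φ, T' φ⟫ / ‖wilsonTorusTransferMatrix ρ β₀ L‖ ∧
        ⟪φ, T' φ⟫ / ‖wilsonTorusTransferMatrix ρ β₀ L‖ ≤
          (Real.log ‖wilsonTorusTransferMatrix ρ (β₀ + h) L‖ -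
            Real.log ‖wilsonTorusTransferMatrix ρ β₀ L‖) / h := by
  set μ : Measure (GaugeConfig 3 L G) := Measure.pi fun _ : Edge 3 L => haarProbability G with hμdef
  have hμ0 : μ ≠ 0 := IsProbabilityMeasure.ne_zero μ
  -- kernel formula of `S β = e^{c_β} 𝕋_β`, derivative-kernel operator, positivity near `β₀`
  have hS : ∀ β : ℝ, ∀ φ : Lp ℝ 2 μ,
      ((Real.exp (sliceKernelConst n β L) • wilsonTorusTransferMatrix ρ β L) φ : GaugeConfig 3 L G → ℝ)
        =ᵐ[μ] fun U => ∫ U', sliceKernel ρ β β U U' * φ U' ∂μ := fun β φ =>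
    wilsonTorusTransferMatrix_smul_ae_eq ρ L hρ β φ
  obtain ⟨S', hS'⟩ := exists_sliceKernelIsoDerivOp (d := 3) (L := L) (μ := μ) ρ hρ β₀
  have hpsd : ∀ᶠ β in 𝓝 β₀, ∀ φ : Lp ℝ 2 μ,
      0 ≤ ⟪φ, (Real.exp (sliceKernelConst n β L) • wilsonTorusTransferMatrix ρ β L) φ⟫ := by
    filter_upwards [Ioi_mem_nhds hβ₀] with β hβ φ
    change 0 ≤ ⟪φ, Real.exp (sliceKernelConst n β L) • wilsonTorusTransferMatrix ρ β L φ⟫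
    rw [real_inner_smul_right]
    exact mul_nonneg (Real.exp_pos _).le
      (inner_wilsonTorusTransferMatrix_self_nonneg L hρ hρu (le_of_lt hβ) φ)
  obtain ⟨φ, hφ1, hφpos, hSφ, hder, hbr⟩ :=
    exists_hasDerivAt_log_norm_sliceKernelOp_iso (μ := μ) ρ hρ hρu hμ0 β₀
      (S := fun β => Real.exp (sliceKernelConst n β L) • wilsonTorusTransferMatrix ρ β L) hS hS' hpsd
  -- the derivative of `𝕋`
  have hT := hasDerivAt_wilsonTorusTransferMatrix ρ L hρ β₀ hS'
  -- norms: `‖S β‖ = e^{c_β} ‖𝕋_β‖`, `𝕋_β ≠ 0`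
  have hTpos : ∀ β, 0 < ‖wilsonTorusTransferMatrix ρ β L‖ := fun β =>
    norm_pos_iff.2 (wilsonTorusTransferMatrix_ne_zero β L hρ)
  have hnormS : ∀ β, ‖Real.exp (sliceKernelConst n β L) • wilsonTorusTransferMatrix ρ β L‖ =
      Real.exp (sliceKernelConst n β L) * ‖wilsonTorusTransferMatrix ρ β L‖ := fun β => by
    rw [norm_smul, Real.norm_of_nonneg (Real.exp_pos _).le]
  have hlogS : ∀ β, Real.log ‖Real.exp (sliceKernelConst n β L) • wilsonTorusTransferMatrix ρ β L‖ =
      β * sliceKernelConst n 1 L + Real.log ‖wilsonTorusTransferMatrix ρ β L‖ := fun β => by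
    rw [hnormS, Real.log_mul (Real.exp_pos _).ne' (hTpos β).ne', Real.log_exp, sliceKernelConst_eq_mul L β]
  -- the Perron vector of `S β₀` is that of `𝕋_{β₀}`
  have hTφ : wilsonTorusTransferMatrix ρ β₀ L φ = ‖wilsonTorusTransferMatrix ρ β₀ L‖ • φ := by
    have h1 : (Real.exp (sliceKernelConst n β₀ L) • wilsonTorusTransferMatrix ρ β₀ L) φ =
        Real.exp (sliceKernelConst n β₀ L) • wilsonTorusTransferMatrix ρ β₀ L φ := rfl
    have h2 := hSφ
    rw [h1, hnormS, mul_smul] at h2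
    exact smul_right_injective _ (Real.exp_pos _).ne' h2
  have hTφ' : ⟪φ, wilsonTorusTransferMatrix ρ β₀ L φ⟫ = ‖wilsonTorusTransferMatrix ρ β₀ L‖ := by
    rw [hTφ, real_inner_smul_right, real_inner_self_eq_norm_sq, hφ1, one_pow, mul_one]
  -- the Hellmann–Feynman numbers: `⟪φ, 𝕋'φ⟫/‖𝕋‖ = ⟪φ, S'φ⟫/‖S β₀‖ − κ`
  have hHF : ⟪φ, (Real.exp (-sliceKernelConst n β₀ L) • S' +
        (-sliceKernelConst n 1 L * Real.exp (-sliceKernelConst n β₀ L)) •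
          (Real.exp (sliceKernelConst n β₀ L) • wilsonTorusTransferMatrix ρ β₀ L)) φ⟫ /
        ‖wilsonTorusTransferMatrix ρ β₀ L‖ =
      ⟪φ, S' φ⟫ / ‖Real.exp (sliceKernelConst n β₀ L) • wilsonTorusTransferMatrix ρ β₀ L‖ -
        sliceKernelConst n 1 L := by
    have e1 : (Real.exp (-sliceKernelConst n β₀ L) • S' +
        (-sliceKernelConst n 1 L * Real.exp (-sliceKernelConst n β₀ L)) •
          (Real.exp (sliceKernelConst n β₀ L) • wilsonTorusTransferMatrix ρ β₀ L)) φ =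
        Real.exp (-sliceKernelConst n β₀ L) • S' φ +
          (-sliceKernelConst n 1 L * Real.exp (-sliceKernelConst n β₀ L)) •
            (Real.exp (sliceKernelConst n β₀ L) • wilsonTorusTransferMatrix ρ β₀ L φ) := rfl
    rw [e1, inner_add_right, real_inner_smul_right, real_inner_smul_right, real_inner_smul_right, hTφ',
      hnormS, Real.exp_neg]
    have hTp := (hTpos β₀).ne'
    have hexp := (Real.exp_pos (sliceKernelConst n β₀ L)).ne'
    field_simp
    ring
  refine ⟨_, φ, hT, hφ1, hφpos, hTφ, ?_, fun h hh => ?_⟩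
  · -- derivative of `log ‖𝕋_β‖ = log ‖S β‖ − κ β`
    have hlin : HasDerivAt (fun β : ℝ => β * sliceKernelConst n 1 L) (sliceKernelConst n 1 L) β₀ :=
      hasDerivAt_mul_const _
    have h := hder.sub hlin
    rw [hHF]
    refine h.congr_of_eventuallyEq (Eventually.of_forall fun β => ?_)
    show Real.log ‖wilsonTorusTransferMatrix ρ β L‖ =
      Real.log ‖Real.exp (sliceKernelConst n β L) • wilsonTorusTransferMatrix ρ β L‖ -
        β * sliceKernelConst n 1 L
    rw [hlogS]; ring
  · -- the bracket, transported from `S` to `𝕋`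
    have hb := hbr h hh
    rw [hHF]
    rw [hlogS, hlogS, hlogS] at hb
    have hh0 : h ≠ 0 := hh.ne'
    constructor
    · have h1 := hb.1
      have e : (β₀ * sliceKernelConst n 1 L + Real.log ‖wilsonTorusTransferMatrix ρ β₀ L‖ -
          ((β₀ - h) * sliceKernelConst n 1 L + Real.log ‖wilsonTorusTransferMatrix ρ (β₀ - h) L‖)) / h =
          (Real.log ‖wilsonTorusTransferMatrix ρ β₀ L‖ -
            Real.log ‖wilsonTorusTransferMatrix ρ (β₀ - h) L‖) / h + sliceKernelConst n 1 L := by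
        field_simp; ring
      rw [e] at h1
      linarith
    · have h2 := hb.2
      have e : ((β₀ + h) * sliceKernelConst n 1 L + Real.log ‖wilsonTorusTransferMatrix ρ (β₀ + h) L‖ -
          (β₀ * sliceKernelConst n 1 L + Real.log ‖wilsonTorusTransferMatrix ρ β₀ L‖)) / h =
          (Real.log ‖wilsonTorusTransferMatrix ρ (β₀ + h) L‖ -
            Real.log ‖wilsonTorusTransferMatrix ρ β₀ L‖) / h + sliceKernelConst n 1 L := by
        field_simp; ring
      rw [e] at h2
      linarith

end Torus

end Literature.MathematicalPhysics.QuantumFieldTheory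

end
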